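import Summits.BirchSwinnertonDyer.Rank1Residual.X1.ParitySqueeze
import Literature.NumberTheory.EllipticCurves.PAdicBSDKatoFiniteProofs
import HarnessLib

/-!
# Route T — the squeeze with an ALGEBRAIC λ LOWER BOUND on the leaf X1 ∩ {r = 0}:
# `μ-part ∧ λ_an = n ∧ λ_alg ≥ n − 1` ⇒ Mazur's main conjecture ⇒ `BSD(E,p)`

HONEST FRAMING (cell `b2b-bsdres`, run/shared/lean/b2b/bsd-rank1-residual/, verbatim in every
file): the goal of the cell is to DELETE the COMBINATION-SHAPED residual classes of the
Birch–Swinnerton-Dyer formula for ALL analytic-rank `≤ 1` elliptic curves over `ℚ` — "full BSD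
formula for every rank `≤ 1` curve in class `C`" assembled STRICTLY from published theorems — so
that the rank-`≤ 1` remainder becomes exactly the CONSTRUCTION-SHAPED classes, which are TYPED
(missing-input `Prop`s), NOT attempted. This is not "finishing BSD". Sub-cell
`b2b-bsdres-eisenstein-p1` (CLASS-OWNERS row "X1 (r=0)"), gen 6: research route; NO CLAIM BEYOND
STATED CLASSES; nothing here changes a label. ONE typed def (`AlgebraicLambdaGE`, "`λ_alg(E,p) ≥ n`",
nothing asserted); everything else is a theorem over PUBLISHED named facts and the cell's typed
per-pair inputs (`MuPartAt`, `AnalyticLambdaEq`).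

WHY THIS FILE. Route P (`X1/ParitySqueeze.lean`, gen 5) closes Mazur's main conjecture at a leaf pair
with `λ_an = 2`: Kato–Wuthrich give `ϖ·L_p = ι(f_E·h)`, the μ-part gives `μ(h) = 0`, parity
(Greenberg Prop. 3.10 + the MTT functional equation) gives `λ(f_E)` and `λ_an` even, and Greenberg's
Thm. 4.1 excludes `λ(f_E) = 0`; so `λ(h) = 0` and `h ∈ Λˣ`. The ONLY place where "`2`" enters is the
last step: a LOWER BOUND `λ(f_E) ≥ 1`. This file isolates that step: **any lower bound
`λ_alg(E,p) = λ(X(E/ℚ_∞)) ≥ k` with `λ_an ≤ k + 1` closes the main conjecture** (with parity; with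
`λ_an ≤ k` even without it) — route T. The lower bound is a TYPED INPUT here
(`AlgebraicLambdaGE W p k`); its source IN PRINT is Greenberg's proof of LNM 1716 Cor. 5.6 (p. 136:
"We will show that `λ_E ≥ |L|`": each bad prime `ℓ` with `p ∣ c_ℓ` puts a `ℤ/p` into
`ker(𝒫_E(ℚ) → 𝒫_E(ℚ_∞))` (Lemma 3.3 and the remark after it: `|ker r_v| = c_v^{(p)}`), hence — through
the snake lemma of the control diagram (Lemma 3.2: `coker h = 0`; Cassels' theorem Prop. 4.13 for the
index `[𝒫 : 𝒢] = #E(ℚ)_p`) — into `coker(Sel_E(ℚ)_p → Sel_E(ℚ_∞)_p^Γ)`, and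
`Sel_E(ℚ_∞)_p ≅ (ℚ_p/ℤ_p)^λ` when `μ_E = 0` (no proper finite-index `Λ`-submodules for `F = ℚ`,
`p` odd, good ordinary or multiplicative reduction: LNM 1716 p. 161 / Prop. 4.15)), run over the
LAYERS `ℚ_m` of the cyclotomic tower (a prime `ℓ ≠ p` has `min(s_ℓ, p^m)` primes above it in `ℚ_m`,
`s_ℓ = p^{ord_p(ℓ^{p−1} − 1) − 1}`, each contributing): at a member `E` with `μ_an(E) = 0`,
`λ_alg ≥ Σ_{ℓ bad, p ∣ c_ℓ(E)} s_ℓ + a − 2·[p ∣ #E(ℚ)_tors]`, where `a ∈ {1, 2}` is the `p`-rank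
of the anomalous local kernel `ker r_𝔭` (`|ker r_𝔭| = #Ẽ(𝔽_p)(p)² = p²`, Lemma 3.4; `a = 2` on the
leaf because `E(ℚ_p)` has a point of order `p` — the type-A kernel `Φ` is `G_{ℚ_p}`-trivial — so
`E(ℚ_p)^∧/(universal norms) = (Ê ⊕ ⟨P⟩)/pÊ ≅ (ℤ/p)²`; HOME/b2b-bsdres-eisenstein-p1/X1R0-GAPMAP.md
§14.2). That composition lives OUTSIDE the kernel (the tree has no local kernels `ker r_v` over the
layers `ℚ_m`); it is a per-pair CERTIFICATE recipe with integer data (Tamagawa numbers, `s_ℓ`,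
torsion), checked by `HOME/b2b-bsdres-eisenstein-p1/routeT/routeT_census.py` against iw-2's two-engine
`λ_an` on all 826 `μ = 0` members of the 770 leaf classes with `N < 2·10⁴` (0 violations of
`bound ≤ λ_an`, equality on 350) and closing **141 of the 315 leaf classes with `λ_an ≥ 4`** (and
432/433 of the `λ_an = 2` classes independently of route P). K. Matsuno, Manuscripta Math. 122 (2007)
289–304 (acq-07131, not yet held) is the expected printed form of the tower bound for curves with a
rational `p`-isogeny; until it is read, `AlgebraicLambdaGE` stays a TYPED input and nothing is booked.

* `AlgebraicLambdaGE W p n` (TYPED): "`λ(X(E/ℚ_∞)) ≥ n`" for the cyclotomic dual datum — nothing asserted.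
* the squeeze in `Λ` is `λ(f_E·h) = λ(f_E) + λ(h)` (`MuLambda.lam_mul`; cf. x1b's
  `RankOneParitySqueeze.isUnit_of_mu_le_of_lam_le`), inlined below.
* `lambdaPartAt_of_algebraicLambdaGE` (`λ_an ≤ k`), `lambdaPartAt_of_algebraicLambdaGE_of_even`
  (`λ_an ≤ k + 1`, `λ_an` even, `Sel_{p^∞}(E/ℚ)` finite, Prop. 3.10) — the λ-PART of `X1/MuLambda.lean`.
* `mazurMainConjecture_of_algebraicLambdaGE(_of_even)` — with `MuPartAt`, Mazur's main conjecture.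
* `Leaf.…` — on the leaf: `BSD(E,p)`; headline **`μ_an = 0 ∧ λ_an = n ∧ λ_alg ≥ n − 1 ⇒ BSD(E,p)`**.
* `Leaf.le_of_algebraicLambdaGE_of_analyticLambdaEq` — consistency (Kato–Wuthrich): a certified
  lower bound never exceeds `λ_an` (the census's falsification test, in the kernel).

References: [GreenbergLNM1716] Lemma 3.2–3.4 and remark (pp. 86–89 of the volume), Prop. 3.10,
Thm. 4.1, Prop. 4.13, Prop. 4.15 and p. 161, Cor. 5.6 (p. 136); [Wuthrich2014] Thm. 16;
[GreenbergVatsal2000] (1)–(2); HOME/b2b-bsdres-eisenstein-p1/X1R0-GAPMAP.md §13–§14.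
-/

noncomputable section

open scoped Classical MatrixGroups ModularForm

open PowerSeries CongruenceSubgroup WeierstrassCurve Literature.NumberTheory.EllipticCurves
  Literature.NumberTheory.EllipticCurves.ModularForms
  Literature.NumberTheory.EllipticCurves.Rank1Residual
  Literature.NumberTheory.EllipticCurves.Greenberg1999
  Summit.BirchSwinnertonDyer.BirchSwinnertonDyer.Theorems.Rank1ResidualX1Defs
  Summit.BirchSwinnertonDyer.Rank1Residual.X1.MuLambda
  Summit.BirchSwinnertonDyer.Rank1Residual.X1.MuPart
  Summit.BirchSwinnertonDyer.Rank1Residual.X1.ParitySqueeze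

set_option autoImplicit false

namespace Summit.BirchSwinnertonDyer.Rank1Residual.X1.TamagawaSqueeze

/-! ## §1. "`λ_alg(E,p) ≥ n`", TYPED (nothing asserted) -/

/-- **"`λ_alg(E,p) ≥ n`" (TYPED; nothing asserted).** For the cyclotomic `ℤ_p`-extension `κ`, a
topological generator `γ`, and every Pontryagin-dual datum `D` (`D.X = X(E/ℚ_∞) = Sel_{p^∞}(E/ℚ_∞)^∧`,
finitely generated and `Λ`-torsion): `n ≤ λ(D.X)`, `λ = dim_{ℚ_p}(X ⊗ ℚ_p)` the tree's
`lambdaInvariant` (= `corank_{ℤ_p} Sel_E(ℚ_∞)_p`, Greenberg's `λ_E`). An INPUT of route T, supplied per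
pair OUTSIDE the kernel by Greenberg's Cor. 5.6 mechanism over the layers `ℚ_m` (module docstring):
at a member with `μ_an = 0`, `n = Σ_{ℓ bad, p ∣ c_ℓ} s_ℓ + a − 2·[p ∣ #E(ℚ)_tors]`.
[cite: GreenbergLNM1716, Cor. 5.6 (proof, p. 136: "We will show that λ_E ≥ |L|") (shape only; nothing asserted)] -/
def AlgebraicLambdaGE (W : WeierstrassCurve ℚ) [W.IsElliptic] [W.IsGloballyMinimal] (p : ℕ)
    [Fact p.Prime] (n : ℕ) : Prop :=
  ∀ (κ : ZpExtension ℚ p) (γ : Field.absoluteGaloisGroup ℚ),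
      κ.IsCyclotomic → κ.IsTopGenerator γ →
    ∀ (D : W.SelmerDualData κ γ) [Module.Finite (IwasawaAlgebra p) D.X], D.IsTorsion →
      n ≤ lambdaInvariant p D.X

/-- `AlgebraicLambdaGE` is monotone: a bound `n` gives every bound `m ≤ n`. [folklore] -/
theorem AlgebraicLambdaGE.mono {W : WeierstrassCurve ℚ} [W.IsElliptic] [W.IsGloballyMinimal] {p : ℕ}
    [Fact p.Prime] {m n : ℕ} (hmn : m ≤ n) (h : AlgebraicLambdaGE W p n) :
    AlgebraicLambdaGE W p m :=
  fun κ γ hκ hγ D _ hX ↦ hmn.trans (h κ γ hκ hγ D hX)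

/-- The trivial bound `λ_alg ≥ 0`. [folklore] -/
theorem algebraicLambdaGE_zero (W : WeierstrassCurve ℚ) [W.IsElliptic] [W.IsGloballyMinimal] (p : ℕ)
    [Fact p.Prime] : AlgebraicLambdaGE W p 0 :=
  fun _ _ _ _ _ _ _ ↦ Nat.zero_le _

/-! ## §2. Route T: the λ-part and Mazur's main conjecture from `λ_an ≤ λ_alg (+1)` -/

section Squeeze

variable {W : WeierstrassCurve ℚ} [W.IsElliptic] [W.IsGloballyMinimal] {p : ℕ} [Fact p.Prime]

/-- **Route T, λ-part (no parity).** `W/ℚ` globally minimal elliptic, `p ≠ 2` good ordinary with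
`E[p]` reducible; granted Wuthrich 2014 Thm. 16 (`hW16`, PUBLISHED): if `λ_an(E,p) = n`
(`AnalyticLambdaEq W p n`) and `λ_alg(E,p) ≥ k` (`AlgebraicLambdaGE W p k`) with `n ≤ k`, then the
λ-part `LambdaPartAt W p` holds (`λ(f_E·h) = n ≤ k ≤ λ(X) = λ(f_E)`, the last equality by the structure
theorem, `ParitySqueeze.lam_generator_eq_lambdaInvariant`). [cite: Wuthrich2014, Thm. 16 (p. 397)]
[cite: GreenbergLNM1716, Cor. 5.6 (proof, p. 136)] -/
theorem lambdaPartAt_of_algebraicLambdaGE (hW16 : Wuthrich2014.charIdeal_dvd_padicLFunction)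
    (hp : p ≠ 2) (hgood : W.HasGoodReductionAtPrime p) (hord : ¬ (p : ℤ) ∣ W.frobeniusTrace p)
    (hred : ¬ W.HasIrreducibleModPGaloisRep p) {n k : ℕ} (hlam : AnalyticLambdaEq W p n)
    (hk : AlgebraicLambdaGE W p k) (hnk : n ≤ k) : LambdaPartAt W p := by
  intro κ γ hκ hγ hγ' _ f hf ϖ hϖ D g h hchar hι
  haveI : Module.Finite (IwasawaAlgebra p) D.X := D.module_finite_holds hγ
  obtain ⟨hX, -⟩ := hW16 W p hp ⟨hgood, hord⟩ hred hκ hγ hγ' hf D ϖ hϖ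
  have hgh : g * h ≠ 0 := mul_ne_zero_of_iota_eq hgood hord hf hϖ D hι
  have hg : g ≠ 0 := fun h0 ↦ hgh (by rw [h0, zero_mul])
  have h1 : lam (g * h) = n := hlam f hf ϖ hϖ (g * h) hι
  have h2 : lam g = lambdaInvariant p D.X := lam_generator_eq_lambdaInvariant D.X hX hg hchar
  have h3 : k ≤ lambdaInvariant p D.X := hk κ γ hκ hγ D hX
  omega

/-- **Route T, λ-part with parity.** As `lambdaPartAt_of_algebraicLambdaGE`, but with the weaker
bound `n ≤ k + 1`, for `n` EVEN and `Sel_{p^∞}(E/ℚ)` finite (so `corank = 0` and `λ(f_E)` is even by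
Greenberg's Prop. 3.10, `h310`, PUBLISHED): `λ(h) = n − λ(f_E)` is even and `≤ 1`, hence `0`.
[cite: GreenbergLNM1716, Prop. 3.10 and §5 p. 183] [cite: Wuthrich2014, Thm. 16 (p. 397)] -/
theorem lambdaPartAt_of_algebraicLambdaGE_of_even
    (hW16 : Wuthrich2014.charIdeal_dvd_padicLFunction)
    (h310 : prop310_selmerCorank_mod_two_eq_lambdaInvariant)
    (hp : p ≠ 2) (hgood : W.HasGoodReductionAtPrime p) (hord : ¬ (p : ℤ) ∣ W.frobeniusTrace p)
    (hred : ¬ W.HasIrreducibleModPGaloisRep p) (hSel : Finite (W.selmerGroupPInfty p))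
    {n k : ℕ} (hn : Even n) (hlam : AnalyticLambdaEq W p n) (hk : AlgebraicLambdaGE W p k)
    (hnk : n ≤ k + 1) : LambdaPartAt W p := by
  intro κ γ hκ hγ hγ' _ f hf ϖ hϖ D g h hchar hι
  haveI : Module.Finite (IwasawaAlgebra p) D.X := D.module_finite_holds hγ
  obtain ⟨hX, -⟩ := hW16 W p hp ⟨hgood, hord⟩ hred hκ hγ hγ' hf D ϖ hϖ
  have hgh : g * h ≠ 0 := mul_ne_zero_of_iota_eq hgood hord hf hϖ D hι
  have hg : g ≠ 0 := fun h0 ↦ hgh (by rw [h0, zero_mul])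
  have hh : h ≠ 0 := fun h0 ↦ hgh (by rw [h0, mul_zero])
  have h1 : lam (g * h) = n := hlam f hf ϖ hϖ (g * h) hι
  have h2 : lam g = lambdaInvariant p D.X := lam_generator_eq_lambdaInvariant D.X hX hg hchar
  have h3 : k ≤ lambdaInvariant p D.X := hk κ γ hκ hγ D hX
  have hcork : W.selmerCorank p = 0 := by
    haveI := hSel
    exact zpCorank_eq_zero_of_finite (W.selmerGroupPInfty p) p
  have heven : Even (lam g) := by
    rw [h2]
    exact prop310_selmerCorank_mod_two_eq_lambdaInvariant.even_lambdaInvariant_of_selmerCorank_eq_zero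
      h310 W p hp hκ hγ D hX hcork
  have hgh2 : Even (lam (g * h)) := by rw [h1]; exact hn
  rw [lam_mul hg hh] at h1 hgh2 ⊢
  obtain ⟨a, ha⟩ := heven
  obtain ⟨b, hb⟩ := hgh2
  omega

/-- **Route T: Mazur's main conjecture** from the μ-part (`MuPartAt W p`, `X1/MuPart.lean` at a
certified member), `λ_an = n` and `λ_alg ≥ k` with `n ≤ k` (Wuthrich Thm. 16: `MC ⟺ μ-part ∧ λ-part`,
`X1/MuLambda.lean`). [cite: Wuthrich2014, Thm. 16 (p. 397)] [cite: GreenbergLNM1716, Cor. 5.6 (proof, p. 136)] -/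
theorem mazurMainConjecture_of_algebraicLambdaGE (hW16 : Wuthrich2014.charIdeal_dvd_padicLFunction)
    (hp : p ≠ 2) (hgood : W.HasGoodReductionAtPrime p) (hord : ¬ (p : ℤ) ∣ W.frobeniusTrace p)
    (hred : ¬ W.HasIrreducibleModPGaloisRep p) (hμ : MuPartAt W p) {n k : ℕ}
    (hlam : AnalyticLambdaEq W p n) (hk : AlgebraicLambdaGE W p k) (hnk : n ≤ k) :
    MazurMainConjecture W p :=
  (mazurMainConjecture_iff_muPart_and_lambdaPart hW16 hp hgood hord hred).mpr
    ⟨hμ, lambdaPartAt_of_algebraicLambdaGE hW16 hp hgood hord hred hlam hk hnk⟩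

/-- **Route T with parity: Mazur's main conjecture** from the μ-part, `λ_an = n` even, `λ_alg ≥ k`,
`n ≤ k + 1`, `Sel_{p^∞}(E/ℚ)` finite, and Greenberg's Prop. 3.10 (`h310`).
[cite: GreenbergLNM1716, Prop. 3.10 and Cor. 5.6 (proof, p. 136)] [cite: Wuthrich2014, Thm. 16 (p. 397)] -/
theorem mazurMainConjecture_of_algebraicLambdaGE_of_even
    (hW16 : Wuthrich2014.charIdeal_dvd_padicLFunction)
    (h310 : prop310_selmerCorank_mod_two_eq_lambdaInvariant)
    (hp : p ≠ 2) (hgood : W.HasGoodReductionAtPrime p) (hord : ¬ (p : ℤ) ∣ W.frobeniusTrace p)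
    (hred : ¬ W.HasIrreducibleModPGaloisRep p) (hSel : Finite (W.selmerGroupPInfty p))
    (hμ : MuPartAt W p) {n k : ℕ} (hn : Even n) (hlam : AnalyticLambdaEq W p n)
    (hk : AlgebraicLambdaGE W p k) (hnk : n ≤ k + 1) : MazurMainConjecture W p :=
  (mazurMainConjecture_iff_muPart_and_lambdaPart hW16 hp hgood hord hred).mpr
    ⟨hμ, lambdaPartAt_of_algebraicLambdaGE_of_even hW16 h310 hp hgood hord hred hSel hn hlam hk hnk⟩

end Squeeze

/-! ## §3. On the leaf X1 ∩ {r = 0}: route T closes `BSD(E,p)` -/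

section Leaf

variable {W : WeierstrassCurve ℚ} [W.IsElliptic] [W.IsGloballyMinimal] {p : ℕ} [Fact p.Prime]

/-- On the leaf `Sel_{p^∞}(E/ℚ)` is finite: `r_an = 0`, so `L(E,1) ≠ 0` (modularity, `hmod`) and
Kato's finiteness follows from Gross–Zagier–Kolyvagin (`hGZK`, tree theorem
`kato_finite_of_L_one_ne_zero_of_rank_eq_analyticRank`). [cite: Kato2004Asterisque, Cor. 14.3 (p. 235)] -/
theorem Leaf.finite_selmerGroupPInfty (hmod : nonempty_modularParametrizationData)
    (hGZK : rank_eq_analyticRank_of_analyticRank_le_one) (hL : RankZero.Leaf W p) :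
    Finite (W.selmerGroupPInfty p) :=
  (kato_finite_of_L_one_ne_zero_of_rank_eq_analyticRank W p hGZK
    (entireLFunction_one_ne_zero_of_analyticRank_eq_zero hmod W hL.analyticRank_eq_zero)).2.2

/-- **Route T on the leaf: Mazur's main conjecture** from `MuPartAt W p`, `λ_an = n`, `λ_alg ≥ k` and
`n ≤ k + 1` — parity is automatic on the leaf (`λ_an` even: `ParitySqueeze.Leaf.even_of_analyticLambdaEq`;
`λ(f_E)` even: Prop. 3.10 at corank `0`). Facts `hW16`, `h310`, `hmod`, `hGZK` all PUBLISHED.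
[cite: GreenbergLNM1716, Prop. 3.10 and Cor. 5.6 (proof, p. 136)] [cite: Wuthrich2014, Thm. 16 (p. 397)] -/
theorem Leaf.mazurMainConjecture_of_algebraicLambdaGE
    (hW16 : Wuthrich2014.charIdeal_dvd_padicLFunction)
    (h310 : prop310_selmerCorank_mod_two_eq_lambdaInvariant)
    (hmod : nonempty_modularParametrizationData)
    (hGZK : rank_eq_analyticRank_of_analyticRank_le_one) (hL : RankZero.Leaf W p)
    (hμ : MuPartAt W p) {n k : ℕ} (hlam : AnalyticLambdaEq W p n) (hk : AlgebraicLambdaGE W p k)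
    (hnk : n ≤ k + 1) : MazurMainConjecture W p :=
  have hX := isClassX1_of_classX1 hL.classX1
  mazurMainConjecture_of_algebraicLambdaGE_of_even hW16 h310 hX.two_ne hX.hasGoodReductionAtPrime
    hX.not_dvd_frobeniusTrace hX.not_hasIrreducibleModPGaloisRep
    (Leaf.finite_selmerGroupPInfty hmod hGZK hL) hμ
    (ParitySqueeze.Leaf.even_of_analyticLambdaEq hW16 hmod hL hlam) hlam hk hnk

/-- **Route T on the leaf: `BSD(E,p)`** (general form), through `RankZero.Leaf.mazurMainConjecture_iff_bsdp`
(Greenberg 4.1 `hGr`, modularity, Gross–Zagier–Kolyvagin; all PUBLISHED).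
[cite: GreenbergLNM1716, Prop. 3.10, Thm. 4.1, Cor. 5.6 (proof, p. 136)] [cite: Wuthrich2014, Thm. 16 (p. 397)] -/
theorem Leaf.bsdp_of_algebraicLambdaGE
    (hW16 : Wuthrich2014.charIdeal_dvd_padicLFunction) (hGr : greenberg_charValue_rankZero)
    (h310 : prop310_selmerCorank_mod_two_eq_lambdaInvariant)
    (hmod : nonempty_modularParametrizationData)
    (hGZK : rank_eq_analyticRank_of_analyticRank_le_one) (hL : RankZero.Leaf W p)
    (hμ : MuPartAt W p) {n k : ℕ} (hlam : AnalyticLambdaEq W p n) (hk : AlgebraicLambdaGE W p k)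
    (hnk : n ≤ k + 1) : BSDp W p :=
  (RankZero.Leaf.mazurMainConjecture_iff_bsdp hW16 hGr hmod hGZK hL).mp
    (Leaf.mazurMainConjecture_of_algebraicLambdaGE hW16 h310 hmod hGZK hL hμ hlam hk hnk)

/-- **Route T, headline form at the `μ = 0` member: `μ_an = 0 ∧ λ_an = n ∧ λ_alg ≥ n − 1 ⇒ BSD(E,p)`**
on the leaf (μ-part automatic at `μ_an = 0`, `MuPart.muPartAt_of_analyticMuLE_zero`). With
`k = Σ_{p ∣ c_ℓ} s_ℓ + 2 − 2·[p ∣ #E(ℚ)_tors]` (Greenberg Cor. 5.6 over the tower) this closes 141 of the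
315 leaf classes with `λ_an ≥ 4` and `N < 2·10⁴` (X1R0-GAPMAP §14); at `n = 2`, `k = 1` it is route P's
conclusion without Thm. 4.1's inequality `hb`. [cite: GreenbergLNM1716, Prop. 3.10, Cor. 5.6 (proof, p. 136)]
[cite: Wuthrich2014, Thm. 16 (p. 397)] -/
theorem Leaf.bsdp_of_muZero_of_algebraicLambdaGE
    (hW16 : Wuthrich2014.charIdeal_dvd_padicLFunction) (hGr : greenberg_charValue_rankZero)
    (h310 : prop310_selmerCorank_mod_two_eq_lambdaInvariant)
    (hmod : nonempty_modularParametrizationData)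
    (hGZK : rank_eq_analyticRank_of_analyticRank_le_one) (hL : RankZero.Leaf W p)
    (hμ0 : AnalyticMuLE W p 0) {n k : ℕ} (hlam : AnalyticLambdaEq W p n)
    (hk : AlgebraicLambdaGE W p k) (hnk : n ≤ k + 1) : BSDp W p :=
  have hX := isClassX1_of_classX1 hL.classX1
  Leaf.bsdp_of_algebraicLambdaGE hW16 hGr h310 hmod hGZK hL
    (muPartAt_of_analyticMuLE_zero hW16 hX.two_ne hX.hasGoodReductionAtPrime
      hX.not_dvd_frobeniusTrace hX.not_hasIrreducibleModPGaloisRep hμ0) hlam hk hnk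

/-- **Route P is route T at `k = 1`:** on the leaf, `MuPartAt ∧ λ_an = 2 ∧ λ_alg ≥ 1 ⇒ BSD(E,p)`.
(Route P obtains `λ_alg ≥ 1` from Greenberg's Thm. 4.1 and `hb`; route T takes it from the Tamagawa
count.) [cite: GreenbergLNM1716, §5 p. 183] [cite: Wuthrich2014, Thm. 16 (p. 397)] -/
theorem Leaf.bsdp_of_lamTwo_of_algebraicLambdaGE_one
    (hW16 : Wuthrich2014.charIdeal_dvd_padicLFunction) (hGr : greenberg_charValue_rankZero)
    (h310 : prop310_selmerCorank_mod_two_eq_lambdaInvariant)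
    (hmod : nonempty_modularParametrizationData)
    (hGZK : rank_eq_analyticRank_of_analyticRank_le_one) (hL : RankZero.Leaf W p)
    (hμ : MuPartAt W p) (hlam2 : AnalyticLambdaEq W p 2) (hk : AlgebraicLambdaGE W p 1) : BSDp W p :=
  Leaf.bsdp_of_algebraicLambdaGE hW16 hGr h310 hmod hGZK hL hμ hlam2 hk (by norm_num)

/-- **Consistency (Kato–Wuthrich direction, `λ_alg ≤ λ_an`): a certified lower bound never exceeds
`λ_an` on the leaf.** If `AlgebraicLambdaGE W p k` and `AnalyticLambdaEq W p n` then `k ≤ n`: the data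
exist (modularity; the cyclotomic `κ, γ`; a dual datum) and `ϖ·L_p = ι(f_E·h)` gives
`n = λ(f_E) + λ(h) ≥ λ(f_E) = λ(X) ≥ k`. This is the kernel form of the census's falsification test
(X1R0-GAPMAP §14.3: 0 violations on 826 members). [cite: Wuthrich2014, Thm. 16 (p. 397)] -/
theorem Leaf.le_of_algebraicLambdaGE_of_analyticLambdaEq
    (hW16 : Wuthrich2014.charIdeal_dvd_padicLFunction) (hmod : nonempty_modularParametrizationData)
    (hL : RankZero.Leaf W p) {n k : ℕ} (hk : AlgebraicLambdaGE W p k) (hn : AnalyticLambdaEq W p n) :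
    k ≤ n := by
  have hX := isClassX1_of_classX1 hL.classX1
  haveI : NeZero (W.conductorNorm ℤ) := ⟨(W.conductorNorm_pos_holds).ne'⟩
  obtain ⟨Dm⟩ := hmod W
  have hf : IsNewformOf W Dm.f := Dm.isNewformOf
  obtain ⟨ϖ, -, hϖeq, -⟩ := Dm.exists_rat_mul_realPeriodRat_eq_plusPeriod
  obtain ⟨κ, hκ, γ, hγ, hγ'⟩ := exists_isCyclotomic_isTopGenerator_isCyclotomicVariable_holds p
  obtain ⟨D⟩ := W.nonempty_selmerDualData_holds κ γ hγ
  haveI : Module.Finite (IwasawaAlgebra p) D.X := D.module_finite_holds hγ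
  obtain ⟨hXt, g, hgmem, hιg⟩ := hW16 W p hX.two_ne
    ⟨hX.hasGoodReductionAtPrime, hX.not_dvd_frobeniusTrace⟩ hX.not_hasIrreducibleModPGaloisRep
    hκ hγ hγ' hf D ϖ hϖeq
  obtain ⟨fE, hchar⟩ := (charIdeal_isPrincipal_holds p D.X).principal
  have hchar' : D.charIdeal = Ideal.span {fE} := hchar
  have hgmem' : g ∈ Ideal.span {fE} := by rw [← hchar']; exact hgmem
  obtain ⟨h, hgh⟩ := Ideal.mem_span_singleton'.mp hgmem'
  have hfac : fE * h = g := by rw [mul_comm]; exact hgh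
  have hι' : iwasawaToPowerSeries p (fE * h) =
      C (ϖ : ℚ_[p]) * padicLFunction Dm.f (unitRoot W p : ℚ_[p]) := by rw [hfac, hιg]
  have hg0 : fE * h ≠ 0 :=
    mul_ne_zero_of_iota_eq hX.hasGoodReductionAtPrime hX.not_dvd_frobeniusTrace hf hϖeq D hι'
  have hfE0 : fE ≠ 0 := fun h0 ↦ hg0 (by rw [h0, zero_mul])
  have hh0 : h ≠ 0 := fun h0 ↦ hg0 (by rw [h0, mul_zero])
  have h1 : lam (fE * h) = n := hn Dm.f hf ϖ hϖeq (fE * h) hι'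
  have h2 : lam fE = lambdaInvariant p D.X := lam_generator_eq_lambdaInvariant D.X hXt hfE0 hchar'
  have h3 : k ≤ lambdaInvariant p D.X := hk κ γ hκ hγ D hXt
  have h4 : lam fE ≤ lam (fE * h) := lam_le_lam_mul hfE0 hh0
  omega

end Leaf

end Summit.BirchSwinnertonDyer.Rank1Residual.X1.TamagawaSqueeze

end
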